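import Mathlib
import Literature.Analysis.FluidPDE.KNSSTypeIIHolds
import Literature.Analysis.FluidPDE.WholeSpaceIBP
import Summits.NavierStokesRegularity.NavierStokesRegularity.Theses.QuasipotentialCoercivity
import HarnessLib

/-!
# `QuasipotentialCoercivity.EnstrophyClosure` — `H¹`-level continuation past the final time
  (item stmt-NavierStokesRegularity-10592)

**Statement.** For `ν > 0`, `T > 0` and a classical solution `(u, p)` of the unforced
Navier–Stokes system on `ℝ³ × [0, T)` which is Leray–Hopf on `[0, T)` from `u 0`, a uniform
enstrophy bound `⨆_{t ∈ [0,T)} ∫ |∇u(t)|²_F < ⊤` gives a classical extension past `T`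
(`HasSmoothExtensionPast ν 0 u T`).  No decay hypothesis on the datum.

PROOF (Leray 1934 / Robinson–Rodrigo–Sadowski 2016, proof of Thm. 12.3, exactly as in the tree's
`Literature.Analysis.FluidPDE.hasSmoothExtensionPast_of_bounded_of_local_H1_theory`, with the
Serrin-class step replaced by the enstrophy hypothesis). Let `a` be the (finite) enstrophy bound
and `τ = c ν³ / (a² + 1)` Leray's `H¹` lifespan (`leray_local_regular_H1_holds`, with `a² τ ≤ c ν³`).
Pick a good restarting time `s ∈ (T − τ/2, T)` (`IsLerayHopfOn.exists_isLerayHopfOn_restart_Ioo`);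
the slice `u s` is `C¹`, in `L²`, weakly divergence free, and its weak dissipation is at most its
classical enstrophy `≤ a` (`eWeakGradL2Sq_le_of_hasWeakGradient`, `hasWeakGradient_fderiv_of_contDiff`).
Leray's local regular solution `(v, q)` from `u s` lives on `[0, τ] ∋ T − s`, lies in `L^∞_t L⁶_x`
(`memLqLp_top_six_of_isH1RegularOn_Icc`), so `u (t + s) = v t` a.e. by the proved weak–strong
uniqueness theorem `serrin_weak_strong_uniqueness_holds`, hence everywhere (continuous slices);
`IsClassicalNSSolutionOn.glue` glues `(v, q)(· − s)` to `(u, p)` along `(s, T)` into a classical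
solution on `[0, s + τ) ⊋ [0, T]`.

HONEST FRAMING: a known continuation criterion (uniform `H¹` bound ⇒ no blow-up at `T`),
assembled from accepted tree theorems; nothing here bears on whether such bounds hold.
-/

noncomputable section

set_option linter.dupNamespace false

namespace Summit.NavierStokesRegularity.NavierStokesRegularity.Theorems

open Set MeasureTheory Filter Topology
open scoped ENNReal
open Literature.Analysis.FluidPDE

/-- **Uniform enstrophy bound ⇒ classical continuation past `T`** (Leray 1934; RRS 2016 Thm.
6.15 + weak–strong uniqueness, proof of Thm. 12.3): a classical solution of unforced NS on
`ℝ³ × [0, T)`, Leray–Hopf on `[0, T)` from `u 0`, with `⨆_{t<T} ∫|∇u(t)|²_F < ⊤`, extends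
classically past `T`. [this file] -/
theorem hasSmoothExtensionPast_of_enstrophy_lt_top {ν T : ℝ} (hν : 0 < ν) (hT : 0 < T)
    {u : ℝ → EuclideanSpace ℝ (Fin 3) → EuclideanSpace ℝ (Fin 3)}
    {p : ℝ → EuclideanSpace ℝ (Fin 3) → ℝ}
    (hcl : IsClassicalNSSolutionOn (Ico 0 T) ν 0 u p) (hLH : IsLerayHopfOn T ν 0 (u 0) u)
    (hens : (⨆ t ∈ Ico 0 T, ∫⁻ y, ENNReal.ofReal (frobeniusNormSq (fderiv ℝ (u t) y))) < ⊤) :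
    HasSmoothExtensionPast ν 0 u T := by
  classical
  have hAtop : (⨆ t ∈ Ico 0 T, ∫⁻ y, ENNReal.ofReal (frobeniusNormSq (fderiv ℝ (u t) y))) ≠ ⊤ :=
    hens.ne
  obtain ⟨c, hc, hlocc⟩ := leray_local_regular_H1_holds
  -- Leray's lifespan for data of squared gradient norm `≤ a`
  set a : ℝ := (⨆ t ∈ Ico 0 T, ∫⁻ y, ENNReal.ofReal (frobeniusNormSq (fderiv ℝ (u t) y))).toReal
    with ha
  have ha0 : 0 ≤ a := ENNReal.toReal_nonneg
  set τ : ℝ := c * ν ^ 3 / (a ^ 2 + 1) with hτ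
  have hcν : 0 < c * ν ^ 3 := mul_pos hc (pow_pos hν 3)
  have hτpos : 0 < τ := div_pos hcν (by positivity)
  have hτc : a ^ 2 * τ ≤ c * ν ^ 3 := by
    have h1 : a ^ 2 * τ = c * ν ^ 3 * (a ^ 2 / (a ^ 2 + 1)) := by
      rw [hτ]
      ring
    rw [h1]
    exact mul_le_of_le_one_right hcν.le (div_le_one_of_le₀ (by linarith) (by positivity))
  -- a good restart time `s ∈ (max (T/2) (T - τ/2), T)`
  set s₀ : ℝ := max (T / 2) (T - τ / 2) with hs₀
  have hs₀0 : 0 ≤ s₀ := le_max_of_le_left (by linarith)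
  have hs₀T : s₀ < T := max_lt (by linarith) (by linarith)
  obtain ⟨s, hs, hLHs⟩ := hLH.exists_isLerayHopfOn_restart_Ioo hν.le hs₀0 hs₀T le_rfl
  have hsT2 : T / 2 ≤ s := (le_max_left _ _).trans hs.1.le
  have hsτ : T < s + τ := by
    have h1 : T - τ / 2 < s := (le_max_right _ _).trans_lt hs.1
    linarith
  have hs0 : 0 < s := by linarith
  have hTs : 0 < T - s := sub_pos.2 hs.2
  have hTsτ : T - s ≤ τ := by linarith
  have hsI : s ∈ Ico 0 T := ⟨hs0.le, hs.2⟩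
  -- the datum `u s ∈ H¹`, weakly divergence free, with `‖∇u(s)‖² ≤ a`
  have hu2 : MemLp (u s) 2 volume := hLH.memLp s ⟨hs0.le, hs.2.le⟩
  have hdiv : IsWeaklyDivFree (u s) := hLHs.isWeaklyDivFree_datum hTs
  have hus1 : ContDiff ℝ 1 (u s) := (hcl.contDiff_velocity hsI).of_le (by norm_cast)
  have hgrad : eWeakGradL2Sq (u s) ≤ ENNReal.ofReal a := by
    calc eWeakGradL2Sq (u s)
        ≤ ∫⁻ y, ENNReal.ofReal (frobeniusNormSq (fderiv ℝ (u s) y)) :=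
          eWeakGradL2Sq_le_of_hasWeakGradient (hasWeakGradient_fderiv_of_contDiff hus1)
      _ ≤ ⨆ t ∈ Ico 0 T, ∫⁻ y, ENNReal.ofReal (frobeniusNormSq (fderiv ℝ (u t) y)) :=
          le_iSup₂ (f := fun t (_ : t ∈ Ico 0 T) =>
            ∫⁻ y, ENNReal.ofReal (frobeniusNormSq (fderiv ℝ (u t) y))) s hsI
      _ = ENNReal.ofReal a := (ENNReal.ofReal_toReal hAtop).symm
  -- Leray's local regular solution `(v, q)` from `u s` on `[0, τ]` (Leray 1934; RRS Thm. 6.15)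
  obtain ⟨v, q, hv, hv0, hvreg, hvcl, -⟩ := hlocc hν hτpos hu2 hdiv ha0 hgrad hτc
  -- it lies in the Serrin class `L^∞_t L⁶_x`
  have hvS : MemLqLp ∞ 6 v (Ioo 0 τ) :=
    memLqLp_top_six_of_isH1RegularOn_Icc hvreg fun t ht => hv.memLp t ht
  have hr6 : (3 : ℝ≥0∞) < 6 := by norm_num
  -- weak–strong uniqueness on `[0, T - s)`: `u (t + s) = v t` a.e., `0 < t ≤ T - s`
  have hae : ∀ t ∈ Ioc 0 (T - s), (fun t => u (t + s)) t =ᵐ[volume] v t :=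
    serrin_weak_strong_uniqueness_holds hν hTs (hv.of_le hTsτ) hu2 (q := ∞) (r := 6) hr6
      serrin_exponents_top_six (hvS.mono_set (Ioo_subset_Ioo_right hTsτ)) hLHs
  -- everywhere agreement of the continuous slices on `(s, T)`
  have heq : ∀ t ∈ Ioo s T, u t = v (t + -s) := by
    intro t ht
    have hts : t - s ∈ Ioc 0 (T - s) := ⟨sub_pos.2 ht.1, by linarith [ht.2]⟩
    have h1 : u t =ᵐ[volume] v (t - s) := by
      have h := hae (t - s) hts
      simpa only [sub_add_cancel] using h
    have hcu : Continuous (u t) :=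
      (hcl.contDiff_velocity ⟨hs0.le.trans ht.1.le, ht.2⟩).continuous
    have hcV : Continuous (v (t - s)) :=
      (hvcl.contDiff_velocity ⟨hts.1, hts.2.trans hTsτ⟩).continuous
    rw [← sub_eq_add_neg]
    exact (Continuous.ae_eq_iff_eq volume hcu hcV).1 h1
  -- the continuation piece `(v, q)(· - s)` on `(s, s + τ)`
  have h₂ : IsClassicalNSSolutionOn (Ioo s (s + τ)) ν 0 (fun t => v (t + -s))
      (fun t => q (t + -s)) := by
    have hVP' := hvcl.comp_add_right (-s)
    have h0 : (fun t => (0 : ℝ → EuclideanSpace ℝ (Fin 3) → EuclideanSpace ℝ (Fin 3)) (t + -s))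
        = 0 := rfl
    rw [h0] at hVP'
    exact hVP'.mono (fun t ht => ⟨by simp only [mem_Ioo] at ht ⊢; linarith [ht.1],
      by simp only [mem_Ioo] at ht ⊢; linarith [ht.2]⟩) isOpen_Ioo.uniqueDiffOn
  -- glue along the overlap `(s, T)`
  exact ⟨s + τ, hsτ, _, _, hcl.glue h₂ hs0.le hs.2 hsτ.le heq, fun t ht => by
    simp only [if_pos ht.2]⟩

/-- **Item stmt-NavierStokesRegularity-10592** (`QuasipotentialCoercivity.EnstrophyClosure`): the
`H¹`-level closure of the route's deciding chain — a uniform enstrophy bound on `[0, T)` continues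
a classical Leray–Hopf solution past `T`; by `hasSmoothExtensionPast_of_enstrophy_lt_top`.
[this file] -/
theorem quasipotentialCoercivity_enstrophyClosure_proof :
    Summit.NavierStokesRegularity.NavierStokesRegularity.Theses.QuasipotentialCoercivity.EnstrophyClosure := by
  unfold Summit.NavierStokesRegularity.NavierStokesRegularity.Theses.QuasipotentialCoercivity.EnstrophyClosure
  intro ν T hν hT u p hcl hLH hens
  exact hasSmoothExtensionPast_of_enstrophy_lt_top hν hT hcl hLH hens

end Summit.NavierStokesRegularity.NavierStokesRegularity.Theorems

end
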